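/-
Origin: expansion seat `planner-pub-hodgecm-mc-sanity-1-0`, handover #3r 2026-08-18T18:55Z md5 8bf5ea15aa3a3d1e3a02c764c473bb0c SUPERSEDES 471f66e43f29 (doc-only; NEW additive leaf, 86 l.; imports HodgeCM.Model.Sanity.DegenerateCores only) (`HOME/mc/pub-hodgecm-mc-sanity-1/lean/KernelsLoadBearing.lean`, md5 8bf5ea15, 86 lines);
landed by the packager successor (mc-unitary-1-g3, gen-8 kit) in gate run 32 as `HodgeCM/Model/Sanity/KernelsLoadBearing.lean` (verbatim).
-/
/-
HodgeCM / MODEL-CONSTRUCTION sub-cell (pub-hodgecm), node SAN — construction prover `pub-hodgecm-mc-sanity-1`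
(seat planner-pub-hodgecm-mc-sanity-1-0), 2026-08-18.  Intended PKG path: `HodgeCM/Model/Sanity/KernelsLoadBearing.lean`.
Imports `Sanity/DegenerateCores.lean` (this seat) only; nothing restated, no new axioms, no hypotheses records, 0 proof holes.
-/
import Summits.HodgeConjecture.HodgeCM.Model.Sanity.DegenerateCores

/-!
# Sanity: the Weil theta kernels are LOAD-BEARING in every model

`DegenerateCores.lean` §2 showed that zero Weil kernels (`C.ZeroKernels`: every `θ_Φ` of every `C.wm V c`
vanishes identically — e.g. the placeholder `withDegenerateWM`) make C6 `Open_thetaReal34All` and C7 `Open_occ` hold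
CONTENT-FREE and reduce C5 `Open_thetaGen12All` to "`emb` kills every theta wedge".  `Toy3Cores.lean` closed the
loop on the toy (`not_gramCore₃_allCharsNonDesign`, using the toy's explicit nonzero Gram vector `Λ(E₀,E₁)`, since
the toy violates Hodge–Riemann).  This file closes it for EVERY universe in the cell's intended regime:

**`not_allCharsNonDesign_of_zeroKernels`**: over a universe with the model facts `M : U.ModelAxioms` and
Hodge–Riemann `(2,0)` (`U.Fact_hodgeRiemann20`) — exactly the outer arguments of E2's consumer
`perL_ofSignRecipe₇` — NO END STATE with identically vanishing theta kernels satisfies the seven inputs; precisely,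
zero kernels + C2 + C3 + C4 already contradict C5 (`not_thetaGen12All_of_zeroKernels`): C3 + `pull_hodge` put the
theta classes in `H^{1,0}`, `cup2_hodge` puts the C4-wedge `ω₁ ∪ ω₂ ≠ 0` in `F²H²`, C2 + HR(2,0) make `emb` injective
there (PKG `ThetaModel.emb_ne_zero`), while C5 with zero kernels says `emb (ω₁ ∪ ω₂) = 0`.

Reading for node E / referee block R (REFEREE-mc3 watch-list SAN-1): in the assembled instance the field `wm` can
never be discharged by a placeholder — any E2 witness over the G0 universe (which must carry `M` and `hHR` for
`perL_of_thetaModelExists_sextic`) has SOME context, SOME `Φ` and SOME point with `θ_Φ ≠ 0`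
(`exists_theta_ne_zero_of_allCharsNonDesign`).
-/

set_option autoImplicit false

noncomputable section

open HodgeCM HodgeCM.Universe

attribute [-instance] Quotient.instMeasurableSpace

namespace HodgeCM

namespace Universe.AdelicThetaCore

variable {U : Universe} {hP : PrintFact_unitaryCompact} {C : U.AdelicThetaCore hP} (h : Bool)
variable (d12 d34 : ∀ {L : CMField}, SeesawCtx L → SideData L)

/-- **Zero kernels + C2 + C3 + C4 contradict C5**, over any universe with the model facts and HR(2,0). -/
theorem not_thetaGen12All_of_zeroKernels (M : U.ModelAxioms) (hHR : U.Fact_hodgeRiemann20) (hθ : C.ZeroKernels)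
    (hC2 : (C.thetaModel h d12 d34).Fact_innerEmb) (hC3 : (C.thetaModel h d12 d34).Open_thetaSub)
    (hC4 : (C.thetaModel h d12 d34).Open_thetaWedge) : ¬ (C.thetaModel h d12 d34).Open_thetaGen12All := by
  intro hC5
  obtain ⟨F, ι₁, V, c, hc⟩ := (C.thetaModel h d12 d34).exists_goodCtx'' (C.design_kappaConj h d12 d34)
    (C.design_frameSignConj h d12 d34)
  obtain ⟨Γ, ω₁, h₁, ω₂, h₂, hne⟩ := hC4 V c hc
  have hH10 : ∀ (i : Fin 4), ∀ ω ∈ (C.thetaModel h d12 d34).Theta V c i Γ, ω ∈ U.H10 (U.pms F ι₁ V Γ) :=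
    fun i ω hω => U.Uiso_le_H10 M.pull_hodge Γ c.K (c.Ψ i) c.σ (hC3 V c hc i Γ hω)
  have hF2 := cup2C_mem_F2 M _ (hH10 0 ω₁ h₁) (hH10 1 ω₂ h₂)
  have hne' := (C.thetaModel h d12 d34).emb_ne_zero M hC2 hHR Γ hF2 hne
  exact hne' ((open_thetaGen12All_iff_of_zeroKernels h d12 d34 hθ).mp hC5 V c
    ((C.thetaModel_goodCtx_iff h d12 d34 ι₁ c).mp hc) Γ ω₁ ω₂ h₁ h₂)

/-- **The Weil kernels are load-bearing in every model**: over a universe with `M` and HR(2,0), an END STATE with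
identically vanishing theta kernels does NOT satisfy the seven all-characters inputs. -/
theorem not_allCharsNonDesign_of_zeroKernels (M : U.ModelAxioms) (hHR : U.Fact_hodgeRiemann20)
    (hθ : C.ZeroKernels) : ¬ (C.thetaModel h d12 d34).AllCharsNonDesign :=
  fun A => not_thetaGen12All_of_zeroKernels h d12 d34 M hHR hθ A.innerEmb A.thetaSub A.thetaWedge A.thetaGen12All

/-- In particular the placeholder `withDegenerateWM` (prl1-g10's degenerate Weil theta model in the `wm` slot) is
never an E2 witness over such a universe, whatever `emb`, `cover`, `Theta` are. -/
theorem not_allCharsNonDesign_withDegenerateWM (M : U.ModelAxioms) (hHR : U.Fact_hodgeRiemann20)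
    (C : U.AdelicThetaCore hP) : ¬ (C.withDegenerateWM.thetaModel h d12 d34).AllCharsNonDesign :=
  not_allCharsNonDesign_of_zeroKernels h d12 d34 M hHR (C.withDegenerateWM_zeroKernels)

/-- **Non-degeneracy witness extracted from any E2 witness**: some theta kernel is nonzero somewhere. -/
theorem exists_theta_ne_zero_of_allCharsNonDesign (M : U.ModelAxioms) (hHR : U.Fact_hodgeRiemann20)
    (A : (C.thetaModel h d12 d34).AllCharsNonDesign) :
    ∃ (L : CMField) (ι₁ : L →+* ℂ) (V : HermSpace3 L ι₁) (c : SeesawCtx L) (Φ : (C.wm V c).SK) (p : _),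
      (C.wm V c).θ Φ p ≠ 0 := by
  by_contra H
  refine not_allCharsNonDesign_of_zeroKernels h d12 d34 M hHR (fun V c Φ => DFunLike.ext _ _ fun p => ?_) A
  by_contra hp
  exact H ⟨_, _, V, c, Φ, p, fun h0 => hp (by rw [h0]; rfl)⟩

end Universe.AdelicThetaCore

end HodgeCM

end
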